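import Summits.ResolutionOfSingularities.ResolutionOfSingularities.Theorems.FrobeniusLadderFInjectiveMacaulayficationTauFloorOneCIChartCore
import Summits.ResolutionOfSingularities.ResolutionOfSingularities.Theorems.FrobeniusLadderFInjectiveMacaulayficationTauFloorOneNotFull
import HarnessLib

/-!
# F4POS-1 (c): THE CI CHART `D(y)` OF `Bl_τ(P2d4C)` IS NON-FULL ALONG THE 3-DIMENSIONAL LOCUS `V(x̄, ȳ, z̄′)` — at the generic point and at EVERY point
# (crux `FInjectiveMacaulayfication` stmt-ResolutionOfSingularities-15315, chain w45a; res-L1-w45a-plan-1 RULINGS R18.4 (2) / R18.10 «F4POS-1 (c) = the CI charts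
# D(y), D(u), D(t) of floor 1 of the τ-tower»; seat res-L1-w45a-stub-1 g10; sibling of res-L1-w45a-stub-2's `…TauFloorOneNotFull` (chart `D(x²)`))

[OURS · L1 W4.5a] Support file (`--supports stmt-ResolutionOfSingularities-15315 --as helper`); def-free, unconditional; replaces the role of NO printed item;
NOT a statement of the manuscript; AI-written (AI review is weaker than expert review).

SETTING (`…TauFloorOneCIChartCore`). `C = k[X₀..X₅]/(g₁, g₂)`, `X 0..5 = x, y, w, u′, t′, z′`, `g₁ = x² − wy`, `g₂ = z′² + y(1 + w²z′ + u′³ + t′³)` — the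
chart `D(y)` of `Bl_τ X`, `X = V(z²+x⁴z+y³+u³+t³)`, `τ = (x²,y,u,t,z)` (`D(u)`, `D(t)` by the symmetry `y ↔ u ↔ t`). The exceptional divisor is `(ȳ)`, with
`E_red = V(x̄, ȳ, z̄′) ≅ 𝔸³_{w,u′,t′}`.
* §1 `𝔭 := (x̄, ȳ, z̄′)` is the kernel of `C → k[X]` killing `x, y, z′` — a prime (`primeXYZ_isPrime`) not containing `w̄` (`mk_X_two_not_mem`), of height one
  (`height_primeXYZ`: minimal over `(x̄)` because `w̄ȳ = x̄²` with `w̄ ∉ 𝔭` and `z̄′² ∈ (ȳ)`; Krull + `x̄` non-zero-divisor from the Core file).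
* §2 ★ `not_fullCl_atPrime_primeXYZ` — `¬ FullCl 2 (C_𝔭)` over ANY field: `dim C_𝔭 = 1`, `(x̄)` is a system of parameters (`ȳ = w̄⁻¹x̄²`, `z̄′² ∈ (x̄²)`),
  `z̄′² ∈ (x̄)^{[2]}` but `z̄′ ∉ (x̄)C_𝔭` — the witness map `C_𝔭 → F[ε]` (`F = Frac k[X]`; `x, y ↦ 0`, `z′ ↦ ε`) kills `(x̄)` and not `z̄′`.
* §3 ★★ `not_fullCl_stalk_of_mem_VXYZ` — characteristic 2: **`¬ FullCl 2 𝒪_{Spec C, v}` for EVERY point `v ∋ x̄, ȳ, z̄′`** (FULL descends to generizations,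
  `ClauseLocalizes.fiClause_of_specializes`). Census words (OURS, counted 0): on the CI charts too, floor 1 of the τ-tower carries a 3-dimensional non-FULL locus
  (the whole reduced exceptional divisor). NOT claimed: the scheme-level identification of `C` with the Rees chart, the CM half (separate file), the cure.
[folklore mathematics, OURS as a certificate; cite: Fedder1983, Prop. 1.7 (context); Matsumura1987, Thm. 13.5]
-/

-- single-problem summit: the doubled namespace component is forced
set_option linter.dupNamespace false

noncomputable section

open AlgebraicGeometry CategoryTheory Literature.AlgebraicGeometry.Resolution TopologicalSpace IsLocalRing MvPolynomial DualNumber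

namespace Summit.ResolutionOfSingularities.ResolutionOfSingularities.Theorems.FInjectiveMacaulayfication.TauFloorOneCIChartNotFull

open Summit.ResolutionOfSingularities.ResolutionOfSingularities.Theorems.FInjectiveMacaulayfication
open SliceableCentre TauFloorOneCIChartCore

/-! ## §1 The prime `𝔭 = (x̄, ȳ, z̄′)` as a kernel; its height -/

/-- The substitution killing `x = X 0`, `y = X 1`, `z′ = X 5`. [plumbing] -/
theorem kill_apply (k : Type) [Field k] (j : Fin 6) :
    aeval (fun i : Fin 6 => if i = 0 ∨ i = 1 ∨ i = 5 then (0 : MvPolynomial (Fin 6) k) else X i) (X j : MvPolynomial (Fin 6) k) =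
      if j = 0 ∨ j = 1 ∨ j = 5 then 0 else X j := by
  rw [aeval_X]

/-- `q − q(x, y, z′ ↦ 0) ∈ (x, y, z′)` for every polynomial `q`. [folklore] -/
theorem sub_aeval_kill_mem (k : Type) [Field k] (q : MvPolynomial (Fin 6) k) :
    q - aeval (fun i : Fin 6 => if i = 0 ∨ i = 1 ∨ i = 5 then (0 : MvPolynomial (Fin 6) k) else X i) q ∈
      Ideal.span ({X 0, X 1, X 5} : Set (MvPolynomial (Fin 6) k)) := by
  induction q using MvPolynomial.induction_on with
  | C a => rw [MvPolynomial.algHom_C]; simp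
  | add p q hp hq =>
    rw [map_add, show p + q - (aeval _ p + aeval _ q) = (p - aeval _ p) + (q - aeval _ q) by ring]
    exact Ideal.add_mem _ hp hq
  | mul_X p i hp =>
    rw [map_mul, kill_apply]
    by_cases hi : i = 0 ∨ i = 1 ∨ i = 5
    · rw [if_pos hi, mul_zero, sub_zero]
      refine Ideal.mul_mem_left _ _ (Ideal.subset_span ?_)
      rcases hi with rfl | rfl | rfl
      · exact Or.inl rfl
      · exact Or.inr (Or.inl rfl)
      · exact Or.inr (Or.inr rfl)
    · rw [if_neg hi, show p * X i - aeval _ p * X i = (p - aeval _ p) * X i by ring]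
      exact Ideal.mul_mem_right _ _ hp

/-- `g₁` and `g₂` die under `x, y, z′ ↦ 0`. [plumbing] -/
theorem aeval_kill_g (k : Type) [Field k] (g₁ g₂ : MvPolynomial (Fin 6) k) (hg₁ : g₁ = X 0 ^ 2 - X 2 * X 1)
    (hg₂ : g₂ = X 5 ^ 2 + X 1 * (1 + X 2 ^ 2 * X 5 + X 3 ^ 3 + X 4 ^ 3)) :
    aeval (fun i : Fin 6 => if i = 0 ∨ i = 1 ∨ i = 5 then (0 : MvPolynomial (Fin 6) k) else X i) g₁ = 0 ∧
      aeval (fun i : Fin 6 => if i = 0 ∨ i = 1 ∨ i = 5 then (0 : MvPolynomial (Fin 6) k) else X i) g₂ = 0 := by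
  rw [hg₁, hg₂]
  simp only [map_add, map_sub, map_mul, map_pow, map_one, kill_apply]
  simp

/-- The kernel of `x, y, z′ ↦ 0` on `k[X]` is `(x, y, z′)`. [folklore] -/
theorem ker_kill_eq (k : Type) [Field k] :
    RingHom.ker (aeval (fun i : Fin 6 => if i = 0 ∨ i = 1 ∨ i = 5 then (0 : MvPolynomial (Fin 6) k) else X i)).toRingHom =
      Ideal.span ({X 0, X 1, X 5} : Set (MvPolynomial (Fin 6) k)) := by
  apply le_antisymm
  · intro q hq
    rw [RingHom.mem_ker] at hq
    have h := sub_aeval_kill_mem k q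
    change q - (aeval _).toRingHom q ∈ _ at h
    rwa [hq, sub_zero] at h
  · rw [Ideal.span_le]
    rintro q hq
    rw [SetLike.mem_coe, RingHom.mem_ker]
    rcases hq with rfl | rfl | rfl
    · change aeval _ (X 0) = 0
      rw [kill_apply]; simp
    · change aeval _ (X 1) = 0
      rw [kill_apply]; simp
    · change aeval _ (X 5) = 0
      rw [kill_apply]; simp

/-- The induced map `C → k[X]` (kill `x, y, z′`). [plumbing] -/
theorem exists_lift_kill (k : Type) [Field k] (g₁ g₂ : MvPolynomial (Fin 6) k) (hg₁ : g₁ = X 0 ^ 2 - X 2 * X 1)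
    (hg₂ : g₂ = X 5 ^ 2 + X 1 * (1 + X 2 ^ 2 * X 5 + X 3 ^ 3 + X 4 ^ 3)) :
    ∃ Ψ : (MvPolynomial (Fin 6) k ⧸ Ideal.span {g₁, g₂}) →+* MvPolynomial (Fin 6) k,
      ∀ q, Ψ (Ideal.Quotient.mk (Ideal.span {g₁, g₂}) q) =
        aeval (fun i : Fin 6 => if i = 0 ∨ i = 1 ∨ i = 5 then (0 : MvPolynomial (Fin 6) k) else X i) q := by
  obtain ⟨h₁, h₂⟩ := aeval_kill_g k g₁ g₂ hg₁ hg₂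
  refine ⟨Ideal.Quotient.lift (Ideal.span {g₁, g₂})
    (aeval (fun i : Fin 6 => if i = 0 ∨ i = 1 ∨ i = 5 then (0 : MvPolynomial (Fin 6) k) else X i)).toRingHom ?_, fun q => ?_⟩
  · intro a ha
    obtain ⟨c, d, rfl⟩ := Ideal.mem_span_pair.mp ha
    change aeval _ (c * g₁ + d * g₂) = 0
    rw [map_add, map_mul, map_mul, h₁, h₂, mul_zero, mul_zero, add_zero]
  · exact Ideal.Quotient.lift_mk _ _ _

/-- ★ **`(x̄, ȳ, z̄′)` is a prime of `C`**: it is the kernel of `C → k[X]`, `x, y, z′ ↦ 0` (onto a domain). [folklore] -/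
theorem primeXYZ_isPrime (k : Type) [Field k] (g₁ g₂ : MvPolynomial (Fin 6) k) (hg₁ : g₁ = X 0 ^ 2 - X 2 * X 1)
    (hg₂ : g₂ = X 5 ^ 2 + X 1 * (1 + X 2 ^ 2 * X 5 + X 3 ^ 3 + X 4 ^ 3)) :
    (Ideal.span ({Ideal.Quotient.mk (Ideal.span {g₁, g₂}) (X 0), Ideal.Quotient.mk (Ideal.span {g₁, g₂}) (X 1),
      Ideal.Quotient.mk (Ideal.span {g₁, g₂}) (X 5)} : Set (MvPolynomial (Fin 6) k ⧸ Ideal.span {g₁, g₂}))).IsPrime := by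
  obtain ⟨Ψ, hΨ⟩ := exists_lift_kill k g₁ g₂ hg₁ hg₂
  have hker : RingHom.ker Ψ = Ideal.span {Ideal.Quotient.mk (Ideal.span {g₁, g₂}) (X 0), Ideal.Quotient.mk (Ideal.span {g₁, g₂}) (X 1),
      Ideal.Quotient.mk (Ideal.span {g₁, g₂}) (X 5)} := by
    apply le_antisymm
    · intro r hr
      obtain ⟨q, rfl⟩ := Ideal.Quotient.mk_surjective r
      rw [RingHom.mem_ker, hΨ] at hr
      have hq : q ∈ Ideal.span ({X 0, X 1, X 5} : Set (MvPolynomial (Fin 6) k)) := by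
        rw [← ker_kill_eq]; exact hr
      have := Ideal.mem_map_of_mem (Ideal.Quotient.mk (Ideal.span {g₁, g₂})) hq
      rwa [Ideal.map_span, Set.image_insert_eq, Set.image_pair] at this
    · rw [Ideal.span_le]
      rintro r hr
      rw [SetLike.mem_coe, RingHom.mem_ker]
      rcases hr with rfl | rfl | rfl
      · rw [hΨ, kill_apply]; simp
      · rw [hΨ, kill_apply]; simp
      · rw [hΨ, kill_apply]; simp
  rw [← hker]
  exact RingHom.ker_isPrime Ψ

/-- `w̄ ∉ 𝔭` (its image under the kill map is `w ≠ 0`). [plumbing] -/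
theorem mk_X_two_not_mem (k : Type) [Field k] (g₁ g₂ : MvPolynomial (Fin 6) k) (hg₁ : g₁ = X 0 ^ 2 - X 2 * X 1)
    (hg₂ : g₂ = X 5 ^ 2 + X 1 * (1 + X 2 ^ 2 * X 5 + X 3 ^ 3 + X 4 ^ 3)) :
    Ideal.Quotient.mk (Ideal.span {g₁, g₂}) (X 2) ∉ (Ideal.span ({Ideal.Quotient.mk (Ideal.span {g₁, g₂}) (X 0),
      Ideal.Quotient.mk (Ideal.span {g₁, g₂}) (X 1), Ideal.Quotient.mk (Ideal.span {g₁, g₂}) (X 5)} :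
        Set (MvPolynomial (Fin 6) k ⧸ Ideal.span {g₁, g₂}))) := by
  obtain ⟨Ψ, hΨ⟩ := exists_lift_kill k g₁ g₂ hg₁ hg₂
  intro hw
  have hzero : ∀ r ∈ (Ideal.span ({Ideal.Quotient.mk (Ideal.span {g₁, g₂}) (X 0), Ideal.Quotient.mk (Ideal.span {g₁, g₂}) (X 1),
      Ideal.Quotient.mk (Ideal.span {g₁, g₂}) (X 5)} : Set (MvPolynomial (Fin 6) k ⧸ Ideal.span {g₁, g₂}))), Ψ r = 0 := by
    intro r hr
    have hle : Ideal.span ({Ideal.Quotient.mk (Ideal.span {g₁, g₂}) (X 0), Ideal.Quotient.mk (Ideal.span {g₁, g₂}) (X 1),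
        Ideal.Quotient.mk (Ideal.span {g₁, g₂}) (X 5)} : Set (MvPolynomial (Fin 6) k ⧸ Ideal.span {g₁, g₂})) ≤ RingHom.ker Ψ := by
      rw [Ideal.span_le]
      rintro r hr
      rw [SetLike.mem_coe, RingHom.mem_ker]
      rcases hr with rfl | rfl | rfl
      · rw [hΨ, kill_apply]; simp
      · rw [hΨ, kill_apply]; simp
      · rw [hΨ, kill_apply]; simp
    exact hle hr
  have h := hzero _ hw
  rw [hΨ, kill_apply] at h
  simp only [Fin.isValue, show ¬((2 : Fin 6) = 0 ∨ (2 : Fin 6) = 1 ∨ (2 : Fin 6) = 5) by decide, if_false] at h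
  exact X_ne_zero _ h

/-- The height of `𝔭 = (x̄, ȳ, z̄′)` is one: `𝔭` is minimal over `(x̄)` (`w̄ȳ = x̄²` with `w̄ ∉ 𝔭`, `z̄′² ∈ (ȳ)`) and `x̄` is a non-zero-divisor.
[cite: Matsumura1987, Thm. 13.5 (Krull)] -/
theorem height_primeXYZ (k : Type) [Field k] (g₁ g₂ : MvPolynomial (Fin 6) k) (hg₁ : g₁ = X 0 ^ 2 - X 2 * X 1)
    (hg₂ : g₂ = X 5 ^ 2 + X 1 * (1 + X 2 ^ 2 * X 5 + X 3 ^ 3 + X 4 ^ 3)) :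
    (Ideal.span ({Ideal.Quotient.mk (Ideal.span {g₁, g₂}) (X 0), Ideal.Quotient.mk (Ideal.span {g₁, g₂}) (X 1),
      Ideal.Quotient.mk (Ideal.span {g₁, g₂}) (X 5)} : Set (MvPolynomial (Fin 6) k ⧸ Ideal.span {g₁, g₂}))).height = 1 := by
  haveI h𝔭 := primeXYZ_isPrime k g₁ g₂ hg₁ hg₂
  have hw := mk_X_two_not_mem k g₁ g₂ hg₁ hg₂
  set R := MvPolynomial (Fin 6) k ⧸ Ideal.span {g₁, g₂}
  set x : R := Ideal.Quotient.mk (Ideal.span {g₁, g₂}) (X 0) with hx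
  set y : R := Ideal.Quotient.mk (Ideal.span {g₁, g₂}) (X 1) with hy
  set w : R := Ideal.Quotient.mk (Ideal.span {g₁, g₂}) (X 2) with hwdef
  set z : R := Ideal.Quotient.mk (Ideal.span {g₁, g₂}) (X 5) with hz
  set 𝔭 : Ideal R := Ideal.span {x, y, z} with h𝔭def
  haveI : (Ideal.span {x}).IsPrincipal := ⟨⟨x, rfl⟩⟩
  have hwy : w * y = x ^ 2 := mk_X_two_mul_X_one k g₁ g₂ hg₁
  have hz2 := TauFloorOneCIChartCore.sq_z_eq k g₁ g₂ hg₂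
  have hmin : 𝔭 ∈ (Ideal.span {x}).minimalPrimes := by
    refine ⟨⟨h𝔭, ?_⟩, ?_⟩
    · rw [Ideal.span_singleton_le_iff_mem]; exact Ideal.subset_span (Or.inl rfl)
    · rintro q ⟨hq, hxq⟩ hq𝔭
      rw [Ideal.span_singleton_le_iff_mem] at hxq
      have hyq : y ∈ q := by
        have hwyq : w * y ∈ q := by rw [hwy]; exact hq.mem_of_pow_mem 1 (by rw [pow_one]; exact Ideal.pow_mem_of_mem _ hxq 2 (by norm_num))
        exact ((hq.mem_or_mem hwyq).resolve_left fun hwq => hw (hq𝔭 hwq))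
      have hzq : z ∈ q := by
        apply hq.mem_of_pow_mem 2
        rw [hz, hz2]
        exact neg_mem (Ideal.mul_mem_right _ _ hyq)
      rw [h𝔭def, Ideal.span_le]
      rintro r hr
      rcases hr with rfl | rfl | rfl
      · exact hxq
      · exact hyq
      · exact hzq
  refine le_antisymm (Ideal.height_le_one_of_isPrincipal_of_mem_minimalPrimes (Ideal.span {x}) 𝔭 hmin) ?_
  rw [Order.one_le_iff_ne_zero, Ne, Ideal.height_eq_zero_iff]
  intro hmin0
  exact notMem_nonZeroDivisors_of_mem_mem_minimalPrimes (Ideal.subset_span (Or.inl rfl) : x ∈ 𝔭) hmin0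
    (mk_X_zero_mem_nonZeroDivisors k g₁ g₂ hg₁ hg₂)

/-! ## §2 The local ring at `𝔭` is one-dimensional and NOT FULL -/

set_option maxHeartbeats 800000 in
-- one localization lift into `Frac(k[X])[ε]` + several ideal-membership computations (same budget as `TauFloorOneNotFull.not_fullCl_atPrime_primeXZ`)
/-- ★ **`¬ FullCl 2 (C_𝔭)` AT THE GENERIC POINT `𝔭 = (x̄, ȳ, z̄′)` OF `E_red`** (ANY field `k`): `dim C_𝔭 = 1`; `(x̄)` is a system of parameters of `C_𝔭`
(`ȳ = w̄⁻¹x̄²`, `z̄′² = −ȳ(…) ∈ (x̄²)`, so `√(x̄) = 𝔭C_𝔭`); `z̄′² ∈ (x̄)^{[2]}`; but `z̄′ ∉ (x̄)C_𝔭` — the map `C_𝔭 → F[ε]`, `F = Frac k[X]`, `x, y ↦ 0`, `z′ ↦ ε`,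
`w, u′, t′ ↦ w, u′, t′` kills `g₁, g₂` and `(x̄)` and sends `z̄′` to `ε ≠ 0` (elements off `𝔭` go to units). So clause 3 of `FullCl 2` fails. [cite: Fedder1983, Prop. 1.7 (context)] -/
theorem not_fullCl_atPrime_primeXYZ (k : Type) [Field k] (g₁ g₂ : MvPolynomial (Fin 6) k) (hg₁ : g₁ = X 0 ^ 2 - X 2 * X 1)
    (hg₂ : g₂ = X 5 ^ 2 + X 1 * (1 + X 2 ^ 2 * X 5 + X 3 ^ 3 + X 4 ^ 3))
    (Q : Ideal (MvPolynomial (Fin 6) k ⧸ Ideal.span {g₁, g₂})) [Q.IsPrime]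
    (hQ : Q = Ideal.span {Ideal.Quotient.mk (Ideal.span {g₁, g₂}) (X 0), Ideal.Quotient.mk (Ideal.span {g₁, g₂}) (X 1),
      Ideal.Quotient.mk (Ideal.span {g₁, g₂}) (X 5)}) :
    ¬ FullCl 2 (Localization.AtPrime Q) := by
  classical
  intro hfull
  set R := MvPolynomial (Fin 6) k ⧸ Ideal.span {g₁, g₂} with hR
  set mk : MvPolynomial (Fin 6) k →+* R := Ideal.Quotient.mk (Ideal.span {g₁, g₂}) with hmk
  set L := Localization.AtPrime Q with hL
  set alg : R →+* L := algebraMap R L with halg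
  -- (1) the dimension
  have hdim : ringKrullDim L = (1 : ℕ) := by
    rw [IsLocalization.AtPrime.ringKrullDim_eq_height Q L, hQ, height_primeXYZ k g₁ g₂ hg₁ hg₂]
    rfl
  -- (2) `w̄` is a unit of `L`; `ȳ ∈ (x̄)L`; `z̄′² = x̄²·c`
  have hw2 : mk (X 2) ∉ Q := by
    rw [hQ]
    exact mk_X_two_not_mem k g₁ g₂ hg₁ hg₂
  have hwunit : IsUnit (alg (mk (X 2))) := IsLocalization.map_units L (⟨mk (X 2), hw2⟩ : Q.primeCompl)
  set s : Fin 1 → L := fun _ => alg (mk (X 0)) with hs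
  have hx0 : alg (mk (X 0)) ∈ Ideal.span (Set.range s) := Ideal.subset_span ⟨0, rfl⟩
  have hwy : alg (mk (X 2)) * alg (mk (X 1)) = alg (mk (X 0)) ^ 2 := by
    rw [← map_mul, ← map_pow, hmk, mk_X_two_mul_X_one k g₁ g₂ hg₁]
  have hy : alg (mk (X 1)) = ↑hwunit.unit⁻¹ * alg (mk (X 0)) ^ 2 := by
    rw [← hwy, ← mul_assoc, IsUnit.val_inv_mul, one_mul]
  have hymem : alg (mk (X 1)) ∈ Ideal.span (Set.range s) := by
    rw [hy, pow_two, ← mul_assoc]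
    exact Ideal.mul_mem_left _ _ hx0
  have hz2 : alg (mk (X 5)) ^ 2 = alg (mk (X 0)) ^ 2 * (-(↑hwunit.unit⁻¹ *
      alg (mk (1 + X 2 ^ 2 * X 5 + X 3 ^ 3 + X 4 ^ 3)))) := by
    have h : alg (mk (X 5)) ^ 2 = -(alg (mk (X 1)) * alg (mk (1 + X 2 ^ 2 * X 5 + X 3 ^ 3 + X 4 ^ 3))) := by
      have := congrArg alg (TauFloorOneCIChartCore.sq_z_eq k g₁ g₂ hg₂)
      simp only [map_pow, map_neg, map_mul, map_add, map_one] at this ⊢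
      exact this
    rw [h, hy]
    ring
  have hz2mem : alg (mk (X 5)) ^ 2 ∈ Ideal.span (Set.range s) := by
    rw [hz2, pow_two, mul_assoc]
    exact Ideal.mul_mem_right _ _ hx0
  have hmaxL : IsLocalRing.maximalIdeal L = Q.map alg := (Localization.AtPrime.map_eq_maximalIdeal (I := Q)).symm
  have hle : Ideal.span (Set.range s) ≤ IsLocalRing.maximalIdeal L := by
    rw [Ideal.span_le]
    rintro _ ⟨j, rfl⟩
    rw [hmaxL]
    refine Ideal.mem_map_of_mem _ ?_
    rw [hQ]
    exact Ideal.subset_span (Or.inl rfl)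
  have hrad_eq : (Ideal.span (Set.range s)).radical = IsLocalRing.maximalIdeal L := by
    apply le_antisymm
    · exact (Ideal.radical_mono hle).trans_eq (IsLocalRing.maximalIdeal.isMaximal L).isPrime.radical
    · rw [hmaxL]
      refine Ideal.map_le_iff_le_comap.mpr fun q hq => ?_
      have hq' : q ∈ Ideal.span ({mk (X 0), mk (X 1), mk (X 5)} : Set R) := hQ ▸ hq
      refine (Ideal.span_le.mpr ?_) hq'
      rintro r hr
      rw [SetLike.mem_coe, Ideal.mem_comap]
      rcases hr with rfl | rfl | rfl
      · exact Ideal.le_radical hx0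
      · exact Ideal.le_radical hymem
      · exact ⟨2, hz2mem⟩
  have hrad : (Ideal.span (Set.range s)).radical.IsMaximal := by
    rw [hrad_eq]; exact IsLocalRing.maximalIdeal.isMaximal L
  -- (3) clause 3 of `FullCl 2` at `y = z̄′`, `e = 1`
  obtain ⟨-, hclause⟩ := hfull
  have hF3 := (hclause 1 hdim s hrad).2 (alg (mk (X 5))) ⟨1, by
    rw [pow_one, hz2]
    exact Ideal.mul_mem_right _ _ (Ideal.subset_span ⟨alg (mk (X 0)), hx0, by simp⟩)⟩
  -- (4) `z̄′ ∉ (x̄) C_𝔭`: evaluate into the dual numbers over `F = Frac k[X]`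
  let Fr := FractionRing (MvPolynomial (Fin 6) k)
  let ι : MvPolynomial (Fin 6) k →+* Fr := algebraMap _ _
  let f : k →+* Fr[ε] := (TrivSqZeroExt.inlHom Fr Fr).comp (ι.comp MvPolynomial.C)
  let v : Fin 6 → Fr[ε] := fun j => if j = 5 then ε else if j = 0 ∨ j = 1 then 0 else TrivSqZeroExt.inl (ι (X j))
  have hv5 : v 5 = ε := by simp [v]
  have hv0 : v 0 = 0 := by simp [v]
  have hv1 : v 1 = 0 := by simp [v]
  have hφg₁ : eval₂Hom f v g₁ = 0 := by
    rw [hg₁]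
    simp only [map_sub, map_mul, map_pow, eval₂Hom_X', hv0, hv1, zero_pow two_ne_zero, mul_zero, sub_zero]
  have hφg₂ : eval₂Hom f v g₂ = 0 := by
    rw [hg₂]
    simp only [map_add, map_mul, map_pow, eval₂Hom_X', hv5, hv1, DualNumber.eps_pow_two, zero_mul, add_zero]
  let φ₁ : R →+* Fr[ε] := Ideal.Quotient.lift (Ideal.span {g₁, g₂}) (eval₂Hom f v) fun a ha => by
    obtain ⟨c, d, rfl⟩ := Ideal.mem_span_pair.mp ha
    rw [map_add, map_mul, map_mul, hφg₁, hφg₂, mul_zero, mul_zero, add_zero]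
  have hφ₁ : ∀ g : MvPolynomial (Fin 6) k, φ₁ (mk g) = eval₂Hom f v g := fun g => Ideal.Quotient.lift_mk _ _ _
  -- the first component of `eval₂Hom f v` is `ι ∘ (x, y, z′ ↦ 0)`
  have hfst : ∀ g : MvPolynomial (Fin 6) k, TrivSqZeroExt.fst (eval₂Hom f v g) =
      ι (aeval (fun i : Fin 6 => if i = 0 ∨ i = 1 ∨ i = 5 then (0 : MvPolynomial (Fin 6) k) else X i) g) := by
    intro g
    have hcomp : (TrivSqZeroExt.fstHom Fr Fr Fr).toRingHom.comp (eval₂Hom f v) =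
        ι.comp (aeval (fun i : Fin 6 => if i = 0 ∨ i = 1 ∨ i = 5 then (0 : MvPolynomial (Fin 6) k) else X i)).toRingHom := by
      refine MvPolynomial.ringHom_ext (fun a => ?_) (fun j => ?_)
      · simp [f, TrivSqZeroExt.inlHom]
      · fin_cases j <;> simp [v]
    have h1 := RingHom.congr_fun hcomp g
    change TrivSqZeroExt.fst (eval₂Hom f v g) = ι (aeval _ g) at h1
    exact h1
  have hunit : ∀ y : Q.primeCompl, IsUnit (φ₁ y) := by
    rintro ⟨y, hy'⟩
    obtain ⟨g, rfl⟩ := Ideal.Quotient.mk_surjective y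
    change IsUnit (φ₁ (mk g))
    rw [hφ₁, TrivSqZeroExt.isUnit_iff_isUnit_fst, hfst, isUnit_iff_ne_zero]
    intro hc
    apply hy'
    have hc' : aeval (fun i : Fin 6 => if i = 0 ∨ i = 1 ∨ i = 5 then (0 : MvPolynomial (Fin 6) k) else X i) g = 0 :=
      (IsFractionRing.injective (MvPolynomial (Fin 6) k) Fr) (by rw [map_zero]; exact hc)
    have hg : g ∈ Ideal.span ({X 0, X 1, X 5} : Set (MvPolynomial (Fin 6) k)) := by
      rw [← ker_kill_eq]; exact hc'
    have := Ideal.mem_map_of_mem mk hg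
    rw [Ideal.map_span, Set.image_insert_eq, Set.image_pair] at this
    change mk g ∈ Q
    rw [hQ]; exact this
  let ψ : L →+* Fr[ε] := IsLocalization.lift (M := Q.primeCompl) (g := φ₁) hunit
  have hψ : ∀ r : R, ψ (alg r) = φ₁ r := fun r => IsLocalization.lift_eq (M := Q.primeCompl) hunit r
  -- `ψ` kills `(s) = (x̄)` …
  have hψs : ∀ u ∈ Ideal.span (Set.range s), ψ u = 0 := by
    intro u hu
    have hmap : Ideal.span (Set.range s) ≤ RingHom.ker ψ := by
      rw [Ideal.span_le]
      rintro _ ⟨j, rfl⟩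
      rw [SetLike.mem_coe, RingHom.mem_ker, hs]
      change ψ (alg (mk (X 0))) = 0
      rw [hψ, hφ₁, eval₂Hom_X', hv0]
    exact hmap hu
  -- … but not `z̄′ ↦ ε`
  have hε : ψ (alg (mk (X 5))) = ε := by
    rw [hψ, hφ₁, eval₂Hom_X', hv5]
  have h0 := hψs _ hF3
  rw [hε] at h0
  have := congrArg TrivSqZeroExt.snd h0
  rw [DualNumber.snd_eps, TrivSqZeroExt.snd_zero] at this
  exact one_ne_zero this

/-! ## §3 ★★ Every point of `V(x̄, ȳ, z̄′) ⊂ Spec C` is a NON-FULL point -/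

/-- ★★ **THE CI CHART `D(y)` OF FLOOR 1 OF THE τ-TOWER OF P2d4C IS NON-FULL AT EVERY POINT OF THE 3-DIMENSIONAL LOCUS `V(x̄, ȳ, z̄′)`** (closed or not,
rational or not; characteristic 2): FULL descends to generizations (`ClauseLocalizes.fiClause_of_specializes`) and the generic point of the locus is not FULL
(§2). With res-L1-w45a-stub-2's `TauFloorOneNotFull.not_fullCl_stalk_of_mem_VXZ` (chart `D(x²)`): the whole reduced exceptional divisor of `Bl_τ X` is a
non-FULL locus, an F(4)-pos configuration (OURS, counted 0; the scheme-level identification with the Rees charts is not claimed here). [OURS · certificate] -/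
theorem not_fullCl_stalk_of_mem_VXYZ (k : Type) [Field k] [CharP k 2] (g₁ g₂ : MvPolynomial (Fin 6) k) (hg₁ : g₁ = X 0 ^ 2 - X 2 * X 1)
    (hg₂ : g₂ = X 5 ^ 2 + X 1 * (1 + X 2 ^ 2 * X 5 + X 3 ^ 3 + X 4 ^ 3))
    (w : Spec (.of (MvPolynomial (Fin 6) k ⧸ Ideal.span {g₁, g₂})))
    (hx : Ideal.Quotient.mk (Ideal.span {g₁, g₂}) (X 0) ∈ w.asIdeal) (hy : Ideal.Quotient.mk (Ideal.span {g₁, g₂}) (X 1) ∈ w.asIdeal)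
    (hz : Ideal.Quotient.mk (Ideal.span {g₁, g₂}) (X 5) ∈ w.asIdeal) :
    ¬ FullCl 2 ((Spec (.of (MvPolynomial (Fin 6) k ⧸ Ideal.span {g₁, g₂}))).presheaf.stalk w) := by
  haveI : Fact (Nat.Prime 2) := ⟨Nat.prime_two⟩
  haveI h𝔭 := primeXYZ_isPrime k g₁ g₂ hg₁ hg₂
  intro hw
  let η : Spec (.of (MvPolynomial (Fin 6) k ⧸ Ideal.span {g₁, g₂})) :=
    ⟨Ideal.span {Ideal.Quotient.mk (Ideal.span {g₁, g₂}) (X 0), Ideal.Quotient.mk (Ideal.span {g₁, g₂}) (X 1),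
      Ideal.Quotient.mk (Ideal.span {g₁, g₂}) (X 5)}, h𝔭⟩
  have hle : η.asIdeal ≤ w.asIdeal := by
    change Ideal.span _ ≤ w.asIdeal
    rw [Ideal.span_le]
    rintro r hr
    rcases hr with rfl | rfl | rfl
    · exact hx
    · exact hy
    · exact hz
  have hηw : η ⤳ w := (PrimeSpectrum.le_iff_specializes _ _).mp ((PrimeSpectrum.asIdeal_le_asIdeal _ _).mp hle)
  haveI : CharP ((Spec (.of (MvPolynomial (Fin 6) k ⧸ Ideal.span {g₁, g₂}))).presheaf.stalk w) 2 :=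
    FTemkinClosedPoints.charP_stalk_of_over 2
      (Spec.map (CommRingCat.ofHom (algebraMap k (MvPolynomial (Fin 6) k ⧸ Ideal.span {g₁, g₂})))) (𝟙 _) w
  have hη := ClauseLocalizes.fiClause_of_specializes 2 hηw hw
  have hL : FullCl 2 (Localization.AtPrime η.asIdeal) :=
    WFixAtNonClosedDimTwo.fullCl_of_ringEquiv 2 (Spec.stalkIso (.of _) η).commRingCatIsoToRingEquiv hη
  exact not_fullCl_atPrime_primeXYZ k g₁ g₂ hg₁ hg₂ η.asIdeal rfl hL

end Summit.ResolutionOfSingularities.ResolutionOfSingularities.Theorems.FInjectiveMacaulayfication.TauFloorOneCIChartNotFull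

end
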